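import Literature.NumberTheory.Transcendental.OddZetaSeries
import HarnessLib

/-!
# Rivoal's very-well-poised series — integral expansions WITH coefficient bounds

Topic `Literature/NumberTheory/Transcendental`. Definitions `IsExpB`, `IsSimpleB` (bounded
versions of the tree's `OddZeta.IsExp`, `OddZeta.IsSimple`); everything else is PROVED.

Nesterenko's criterion needs, besides the arithmetic (`d_n^{a+1-i} c_{k,i} ∈ ℤ`) of the
partial-fraction coefficients of the Ball–Rivoal rational function, their GROWTH
(`limsup |c_{k,i}|^{1/n} ≤ 2^{a+O(r)} r^{O(r)}`, Rivoal 2000, Lemme 4; Ball–Rivoal 2001, Lemme 4 —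
there by Cauchy's formula). We obtain it elementarily by running the product construction of
`OddZetaPartialFractions.lean` (Zudilin 2018, Lemma 1; Fischler–Sprang–Zudilin 2019, §3) while
keeping track of a uniform bound on the coefficients:

* `IsExpB n p f C`: an integral expansion of level `p` all of whose coefficients are `≤ C` in
  absolute value; closure under sums, and the product step `IsExpB.mul_isSimpleB`
  (bound multiplied by the residue bound and a factor `(n+1)²(p+1)`), iterated in
  `IsExpB.mul_prod_isSimpleB`;
* residue bounds for the three building blocks with `D = 1`: `n!/∏(t+k)` (`2^n`),
  `n!(t-R)/∏(t+k)` (`2^n (n+R)`), `∏_{j<n}(t+A+j+1)/∏(t+k)` (`2^n · C(|A|+2n+1, n)`);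
* `isExpB_Rfun`: the Ball–Rivoal function `OddZeta.Rfun r 1 a n` (= Rivoal's `R_n`,
  `RivoalSeries.Rfun_one_eq_ratfun`) has an integral expansion of level `a+1` with all
  coefficients `≤ coeffBound a r n`, where `coeffBound a r n = κ^n · poly(n)`,
  `κ = 2^{a+1} (r+3... )` — see `coeffBound`;
* `linear_forms_bound`: the symmetrised expansion and the linear forms
  `∑_{m ≥ 0} R_n(m+2) = ρ₀ + ∑_{2 ≤ i ≤ a+1} ρ_i ζ(i)` with `ρ_i = 0` for even `i`,
  `2 d_n^{a+1-i} ρ_i ∈ ℤ`, `2 d_{n+1}^{a+1} ρ₀ ∈ ℤ` (as in the tree's `OddZeta.linear_forms`)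
  AND `|ρ_i| ≤ (n+1) coeffBound`, `|ρ₀| ≤ (n+1)²(a+1) coeffBound`.

## References

* T. Rivoal, C. R. Acad. Sci. Paris 331 (2000) 267–270, Lemmes 4, 5. [Rivoal2000]
* K. Ball, T. Rivoal, Invent. Math. 146 (2001) 193–207, Lemmes 1, 4, 5. [BallRivoal2001]
* W. Zudilin, SIGMA 14 (2018) 028, Lemma 1. [Zudilin2018OddZeta]
* S. Fischler, J. Sprang, W. Zudilin, Compositio Math. 155 (2019), §3. [FischlerSprangZudilin2019]
-/

noncomputable section

open Finset Filter
open scoped Nat Topology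

namespace Literature.NumberTheory.Transcendental

namespace RivoalSeries

open OddZeta

/-! ### Bounded integral expansions -/

/-- `IsExpB n p f C`: off the poles `0,…,-n`, `f` is an integral expansion of level `p`
(`OddZeta.IsExp`) all of whose coefficients are bounded by `C` in absolute value. [folklore] -/
def IsExpB (n p : ℕ) (f : ℝ → ℝ) (C : ℝ) : Prop :=
  ∃ c : ℕ → ℕ → ℝ, (∀ k i, IsZ (dn n ^ (p - i) * c k i)) ∧ (∀ k i, |c k i| ≤ C) ∧
    ∀ t, Good n t → f t = pfEval n p c t

namespace IsExpB

variable {n p : ℕ} {f g : ℝ → ℝ} {C C' : ℝ}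

/-- Forgetting the bound. [folklore] -/
theorem isExp (h : IsExpB n p f C) : IsExp n p f := by
  obtain ⟨c, hc, -, hf⟩ := h; exact ⟨c, hc, hf⟩

/-- The bound is non-negative. [folklore] -/
theorem nonneg (h : IsExpB n p f C) : 0 ≤ C := by
  obtain ⟨c, -, hb, -⟩ := h; exact (abs_nonneg _).trans (hb 0 0)

/-- `IsExpB` only depends on the values off the poles. [folklore] -/
theorem congr (h : IsExpB n p f C) (hfg : ∀ t, Good n t → g t = f t) : IsExpB n p g C := by
  obtain ⟨c, hc, hb, hf⟩ := h
  exact ⟨c, hc, hb, fun t ht => (hfg t ht).trans (hf t ht)⟩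

/-- Weakening the bound. [folklore] -/
theorem mono_bound (h : IsExpB n p f C) (hC : C ≤ C') : IsExpB n p f C' := by
  obtain ⟨c, hc, hb, hf⟩ := h
  exact ⟨c, hc, fun k i => (hb k i).trans hC, hf⟩

/-- The zero function. [folklore] -/
theorem zero : IsExpB n p (fun _ => 0) 0 :=
  ⟨fun _ _ => 0, fun _ _ => by simpa using IsZ.zero, fun _ _ => by simp, fun t _ => by simp [pfEval]⟩

/-- Sums. [folklore] -/
theorem add (hf : IsExpB n p f C) (hg : IsExpB n p g C') :
    IsExpB n p (fun t => f t + g t) (C + C') := by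
  obtain ⟨c, hc, hb, hf⟩ := hf
  obtain ⟨c', hc', hb', hg⟩ := hg
  refine ⟨fun k i => c k i + c' k i, fun k i => ?_, fun k i => ?_, fun t ht => ?_⟩
  · rw [mul_add]; exact (hc k i).add (hc' k i)
  · exact (abs_add_le _ _).trans (add_le_add (hb k i) (hb' k i))
  · beta_reduce
    rw [hf t ht, hg t ht, pfEval, pfEval, pfEval, ← sum_add_distrib]
    refine sum_congr rfl fun k _ => ?_
    rw [← sum_add_distrib]
    refine sum_congr rfl fun i _ => ?_
    ring

/-- Finite sums: the bounds add up. [folklore] -/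
theorem sum {ι : Type*} (s : Finset ι) {F : ι → ℝ → ℝ} {B : ℝ}
    (h : ∀ j ∈ s, IsExpB n p (F j) B) :
    IsExpB n p (fun t => ∑ j ∈ s, F j t) (s.card * B) := by
  classical
  induction s using Finset.induction_on with
  | empty =>
    refine (zero : IsExpB n p (fun _ => 0) 0).mono_bound ?_ |>.congr fun t _ => by simp
    simp
  | insert a s ha ih =>
    have h1 := (h a (mem_insert_self a s)).add (ih fun j hj => h j (mem_insert_of_mem hj))
    rw [card_insert_of_notMem ha]
    refine (h1.mono_bound (le_of_eq ?_)).congr fun t _ => ?_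
    · push_cast; ring
    · rw [sum_insert ha]

end IsExpB

/-- A single term `a/(t+k)^i` (`k ≤ n`, `1 ≤ i ≤ p`, `d_n^{p-i} a ∈ ℤ`) is a bounded integral
expansion with bound `|a|`. [folklore] -/
theorem isExpB_single {n p k i : ℕ} {a : ℝ} (hk : k ≤ n) (hi1 : 1 ≤ i) (hip : i ≤ p)
    (ha : IsZ (dn n ^ (p - i) * a)) : IsExpB n p (fun t => a / (t + k) ^ i) |a| := by
  classical
  refine ⟨fun k' i' => if k' = k ∧ i' = i then a else 0, fun k' i' => ?_, fun k' i' => ?_,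
    fun t _ => ?_⟩
  · beta_reduce
    by_cases h : k' = k ∧ i' = i
    · rw [if_pos h, h.2]; exact ha
    · rw [if_neg h, mul_zero]; exact IsZ.zero
  · beta_reduce
    by_cases h : k' = k ∧ i' = i
    · rw [if_pos h]
    · rw [if_neg h, abs_zero]; exact abs_nonneg _
  · beta_reduce
    rw [pfEval]
    rw [sum_eq_single_of_mem k (mem_range.2 (by omega))]
    · rw [sum_eq_single_of_mem i (mem_Icc.2 ⟨hi1, hip⟩)]
      · simp
      · intro i' _ hi'
        simp [hi']
    · intro k' _ hk'
      refine sum_eq_zero fun i' _ => ?_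
      simp [hk']

/-- The cross term `a e/((t+k)^i (t+k'))` (`k ≠ k'` in `[0,n]`, `1 ≤ i ≤ p`, `d_n^{p-i} a ∈ ℤ`,
`e ∈ ℤ`) is a bounded integral expansion of level `p+1` with bound `(p+1)|a||e|`: the
two-centre identity produces coefficients `± a e/(k'-k)^j`, `|k'-k| ≥ 1`.
[cite: Zudilin2018OddZeta, Lemma 1] -/
theorem isExpB_cross {n p k k' i : ℕ} {a e : ℝ} (hk : k ≤ n) (hk' : k' ≤ n) (hne : k ≠ k')
    (hip : i ≤ p) (ha : IsZ (dn n ^ (p - i) * a)) (he : IsZ e) :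
    IsExpB n (p + 1) (fun t => a * e / ((t + k) ^ i * (t + k'))) ((p + 1) * (|a| * |e|)) := by
  set δ : ℝ := (k' : ℝ) - k with hδ
  have hδ1 : 1 ≤ |δ| := by
    rw [hδ]
    have : (1 : ℤ) ≤ |(k' : ℤ) - k| := Int.one_le_abs (by omega)
    have h' : ((1 : ℤ) : ℝ) ≤ (|(k' : ℤ) - k| : ℤ) := by exact_mod_cast this
    push_cast at h'
    exact h'
  have hδ0 : δ ≠ 0 := by
    intro h; rw [h, abs_zero] at hδ1; linarith
  have hq : IsZ (dn n / δ) := isZ_dn_div_sub hk hk' hne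
  have hae : 0 ≤ |a| * |e| := by positivity
  -- a coefficient `a e (-1)^b / δ^j` is bounded by `|a||e|`
  have hcoef : ∀ b j : ℕ, |a * e * (-1) ^ b / δ ^ j| ≤ |a| * |e| := by
    intro b j
    rw [abs_div, abs_mul, abs_mul, abs_pow, abs_pow, abs_neg, abs_one, one_pow, mul_one]
    exact div_le_self hae (one_le_pow₀ hδ1)
  -- the main terms
  have h1 : IsExpB n (p + 1) (fun t => ∑ b ∈ range i,
      (a * e * (-1) ^ b / δ ^ (b + 1)) / (t + k) ^ (i - b)) ((range i).card * (|a| * |e|)) := by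
    refine IsExpB.sum _ fun b hb => ?_
    have hb' : b < i := mem_range.1 hb
    refine (isExpB_single hk (by omega) (by omega) ?_).mono_bound (hcoef b (b + 1))
    have e1 : p + 1 - (i - b) = (p - i) + (b + 1) := by omega
    have : dn n ^ (p + 1 - (i - b)) * (a * e * (-1) ^ b / δ ^ (b + 1)) =
        (dn n ^ (p - i) * a) * e * (-1) ^ b * (dn n / δ) ^ (b + 1) := by
      rw [e1, pow_add, div_pow]; ring
    rw [this]
    exact ((ha.mul he).mul (IsZ.neg_one_pow b)).mul (hq.pow _)
  -- the last term
  have h2 : IsExpB n (p + 1) (fun t => (a * e * (-1) ^ i / δ ^ i) / (t + k') ^ 1) (|a| * |e|) := by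
    refine (isExpB_single hk' le_rfl (by omega) ?_).mono_bound (hcoef i i)
    have : dn n ^ (p + 1 - 1) * (a * e * (-1) ^ i / δ ^ i) =
        (dn n ^ (p - i) * a) * e * (-1) ^ i * (dn n / δ) ^ i := by
      rw [show p + 1 - 1 = (p - i) + i by omega, pow_add, div_pow]; ring
    rw [this]
    exact ((ha.mul he).mul (IsZ.neg_one_pow i)).mul (hq.pow _)
  rw [card_range] at h1
  refine ((h1.add h2).mono_bound ?_).congr fun t ht => ?_
  · have : (i : ℝ) ≤ p := by exact_mod_cast hip
    nlinarith
  have hu : t + k ≠ 0 := ht k hk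
  have hv : t + k + δ ≠ 0 := by
    have := ht k' hk'
    rw [hδ]; convert this using 1; ring
  have hid := one_div_pow_mul (t + k) δ hu hv hδ0 i
  have ev : t + k + δ = t + k' := by rw [hδ]; ring
  rw [ev] at hid
  calc a * e / ((t + ↑k) ^ i * (t + ↑k'))
      = a * e * (1 / ((t + ↑k) ^ i * (t + ↑k'))) := by rw [mul_one_div]
    _ = a * e * (∑ b ∈ range i, (-1) ^ b / (δ ^ (b + 1) * (t + k) ^ (i - b))
          + (-1) ^ i / (δ ^ i * (t + k'))) := by rw [hid]
    _ = _ := by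
      rw [mul_add, mul_sum, pow_one]
      congr 1
      · refine sum_congr rfl fun b _ => ?_
        field_simp
      · field_simp

/-! ### Bounded simple factors and the product step -/

/-- `IsSimpleB n g E`: off the poles, `g t = ∑_{k ≤ n} e_k/(t+k)` with integer residues
`|e_k| ≤ E`. [folklore] -/
def IsSimpleB (n : ℕ) (g : ℝ → ℝ) (E : ℝ) : Prop :=
  ∃ e : ℕ → ℤ, (∀ k, |(e k : ℝ)| ≤ E) ∧ ∀ t, Good n t → g t = ∑ k ∈ range (n + 1), (e k : ℝ) / (t + k)

/-- The residue bound is non-negative. [folklore] -/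
theorem IsSimpleB.nonneg {n : ℕ} {g : ℝ → ℝ} {E : ℝ} (hg : IsSimpleB n g E) : 0 ≤ E := by
  obtain ⟨e, he, -⟩ := hg; exact (abs_nonneg _).trans (he 0)

/-- A bounded simple factor is a bounded expansion of level `1`. [folklore] -/
theorem IsSimpleB.isExpB {n : ℕ} {g : ℝ → ℝ} {E : ℝ} (hg : IsSimpleB n g E) :
    IsExpB n 1 g ((n + 1) * E) := by
  obtain ⟨e, heb, he⟩ := hg
  have hE : 0 ≤ E := (abs_nonneg _).trans (heb 0)
  have h : IsExpB n 1 (fun t => ∑ k ∈ range (n + 1), (e k : ℝ) / (t + k) ^ 1)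
      ((range (n + 1)).card * E) := by
    refine IsExpB.sum _ fun k hk => ?_
    refine (isExpB_single (by simpa [Nat.lt_succ_iff] using hk) le_rfl le_rfl ?_).mono_bound (heb k)
    simpa using IsZ.int (e k)
  rw [card_range] at h
  refine (h.mono_bound (le_of_eq (by push_cast; ring))).congr fun t ht => ?_
  rw [he t ht]
  simp

/-- **Product step with bounds**: an expansion of level `p ≥ 1` with coefficients `≤ C` times a
simple factor with residues `≤ E` is an expansion of level `p+1` with coefficients
`≤ (n+1)² p (p+1) C E`. [cite: Zudilin2018OddZeta, Lemma 1] -/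
theorem IsExpB.mul_isSimpleB {n p : ℕ} {f g : ℝ → ℝ} {C E : ℝ} (hf : IsExpB n p f C)
    (hg : IsSimpleB n g E) :
    IsExpB n (p + 1) (fun t => f t * g t) (((n : ℝ) + 1) ^ 2 * p * (p + 1) * C * E) := by
  have hC : 0 ≤ C := hf.nonneg
  have hE : 0 ≤ E := hg.nonneg
  obtain ⟨c, hc, hcb, hf⟩ := hf
  obtain ⟨e, heb, he⟩ := hg
  -- each elementary product is a bounded expansion of level `p + 1`, bound `(p+1) C E`
  have hterm : ∀ k ∈ range (n + 1), ∀ i ∈ Icc 1 p, ∀ k' ∈ range (n + 1),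
      IsExpB n (p + 1) (fun t => c k i * e k' / ((t + k) ^ i * (t + k'))) ((p + 1) * (C * E)) := by
    intro k hk i hi k' hk'
    have hkn : k ≤ n := by simpa [Nat.lt_succ_iff] using hk
    have hkn' : k' ≤ n := by simpa [Nat.lt_succ_iff] using hk'
    obtain ⟨hi1, hip⟩ := mem_Icc.1 hi
    have hce : |c k i| * |(e k' : ℝ)| ≤ C * E := mul_le_mul (hcb k i) (heb k') (abs_nonneg _) hC
    by_cases hkk : k = k'
    · subst hkk
      have h1 : IsExpB n (p + 1) (fun t => (c k i * e k) / (t + k) ^ (i + 1)) |c k i * e k| := by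
        refine isExpB_single hkn (by omega) (by omega) ?_
        rw [show p + 1 - (i + 1) = p - i by omega, ← mul_assoc]
        exact (hc k i).mul (IsZ.int _)
      refine (h1.mono_bound ?_).congr fun t _ => by rw [pow_succ]
      rw [abs_mul]
      have : (0 : ℝ) ≤ p * (C * E) := by positivity
      linarith
    · exact (isExpB_cross hkn hkn' hkk hip (hc k i) (IsZ.int _)).mono_bound (by nlinarith)
  have hsum : IsExpB n (p + 1) (fun t => ∑ k ∈ range (n + 1), ∑ i ∈ Icc 1 p,
      ∑ k' ∈ range (n + 1), c k i * e k' / ((t + k) ^ i * (t + k')))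
      ((range (n + 1)).card * ((Icc 1 p).card * ((range (n + 1)).card * ((p + 1) * (C * E))))) :=
    IsExpB.sum _ fun k hk => IsExpB.sum _ fun i hi => IsExpB.sum _ fun k' hk' => hterm k hk i hi k' hk'
  rw [card_range, Nat.card_Icc, show p + 1 - 1 = p by omega] at hsum
  refine (hsum.mono_bound (le_of_eq (by push_cast; ring))).congr fun t ht => ?_
  rw [hf t ht, he t ht, pfEval, sum_mul]
  refine sum_congr rfl fun k hk => ?_
  rw [sum_mul]
  refine sum_congr rfl fun i _ => ?_
  rw [mul_sum]
  refine sum_congr rfl fun k' hk' => ?_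
  have h1 : t + k ≠ 0 := ht k (by simpa [Nat.lt_succ_iff] using hk)
  have h2 : t + k' ≠ 0 := ht k' (by simpa [Nat.lt_succ_iff] using hk')
  field_simp

/-- Iterated product step with a uniform level cap `P`: multiplying an expansion of level `p`
(bound `C`) by the simple factors `g_j`, `j ∈ s` (residue bounds `E_j ≥ 0`), `p + |s| ≤ P`,
gives level `p + |s|` and bound `C · ∏ E_j · ((n+1)² P (P+1))^{|s|}`.
[cite: Zudilin2018OddZeta, Lemma 1] -/
theorem IsExpB.mul_prod_isSimpleB {n p P : ℕ} {f : ℝ → ℝ} {C : ℝ} (hf : IsExpB n p f C)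
    {ι : Type*} (s : Finset ι) {g : ι → ℝ → ℝ} {E : ι → ℝ}
    (hg : ∀ j ∈ s, IsSimpleB n (g j) (E j)) (hP : p + s.card ≤ P) :
    IsExpB n (p + s.card) (fun t => f t * ∏ j ∈ s, g j t)
      (C * (∏ j ∈ s, E j) * (((n : ℝ) + 1) ^ 2 * P * (P + 1)) ^ s.card) := by
  classical
  induction s using Finset.induction_on with
  | empty => simpa using hf
  | insert a s ha ih =>
    have hP' : p + s.card ≤ P := by rw [card_insert_of_notMem ha] at hP; omega
    have h0 := ih (fun j hj => hg j (mem_insert_of_mem hj)) hP'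
    have h1 := h0.mul_isSimpleB (hg a (mem_insert_self a s))
    rw [card_insert_of_notMem ha, ← add_assoc]
    have hEa : 0 ≤ E a := (hg a (mem_insert_self a s)).nonneg
    have hC : 0 ≤ C := hf.nonneg
    have hEprod : 0 ≤ ∏ j ∈ s, E j := prod_nonneg fun j hj => (hg j (mem_insert_of_mem hj)).nonneg
    refine (h1.mono_bound ?_).congr fun t _ => ?_
    · rw [prod_insert ha, pow_succ]
      have hlev : ((p + s.card : ℕ) : ℝ) ≤ P := by exact_mod_cast hP'
      have hlev1 : ((p + s.card : ℕ) : ℝ) + 1 ≤ P + 1 := by linarith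
      have hbase : 0 ≤ C * (∏ j ∈ s, E j) * (((n : ℝ) + 1) ^ 2 * P * (P + 1)) ^ s.card := by
        positivity
      have hn2 : (0 : ℝ) ≤ ((n : ℝ) + 1) ^ 2 := by positivity
      calc ((n : ℝ) + 1) ^ 2 * ((p + s.card : ℕ) : ℝ) * (((p + s.card : ℕ) : ℝ) + 1) *
            (C * (∏ j ∈ s, E j) * (((n : ℝ) + 1) ^ 2 * P * (P + 1)) ^ s.card) * E a
          ≤ ((n : ℝ) + 1) ^ 2 * P * (P + 1) *
            (C * (∏ j ∈ s, E j) * (((n : ℝ) + 1) ^ 2 * P * (P + 1)) ^ s.card) * E a := by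
            gcongr
      _ = C * (E a * ∏ j ∈ s, E j) *
            ((((n : ℝ) + 1) ^ 2 * P * (P + 1)) ^ s.card * (((n : ℝ) + 1) ^ 2 * P * (P + 1))) := by
            ring
    · rw [prod_insert ha]
      ring

/-! ### Residue bounds for the three building blocks (`D = 1`) -/

/-- **`G` with bounds**: `n!/∏_{k ≤ n}(t+k)` has residues `(-1)^k C(n,k)`, bounded by `2^n`.
[cite: FischlerSprangZudilin2019, §3 (function G)] -/
theorem isSimpleB_G (n : ℕ) :
    IsSimpleB n (fun t => (n ! : ℝ) / ∏ k ∈ range (n + 1), (t + k)) ((2 : ℝ) ^ n) := by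
  refine ⟨fun k => (-1) ^ k * (n.choose k : ℤ), fun k => ?_, fun t ht => ?_⟩
  · push_cast
    rw [abs_mul, abs_pow, abs_neg, abs_one, one_pow, one_mul, Nat.abs_cast]
    exact_mod_cast Nat.choose_le_two_pow n k
  · have h := eval_div_prod_eq_sum (n := n) (Polynomial.C (n ! : ℝ)) (by simp) t ht
    simp only [Polynomial.eval_C] at h
    beta_reduce
    rw [h]
    refine sum_congr rfl fun k hk => ?_
    have hkn : k ≤ n := by simpa [Nat.lt_succ_iff] using hk
    have e : (((-1 : ℤ) ^ k * (n.choose k : ℤ) : ℤ) : ℝ) = (-1) ^ k * ((n ! : ℝ) / (k ! * (n - k)!)) := by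
      push_cast
      rw [factorial_div_eq_choose hkn]
    rw [e]
    congr 1
    ring

/-- **`G̃` with bounds**: `n!(t-R)/∏_{k ≤ n}(t+k)` (`n ≥ 1`) has residues
`(-1)^{k+1} C(n,k)(k+R)`, bounded by `2^n (n+R)`. [cite: FischlerSprangZudilin2019, §3] -/
theorem isSimpleB_Gtilde (n R : ℕ) (hn : 1 ≤ n) :
    IsSimpleB n (fun t => (n ! : ℝ) * (t - R) / ∏ k ∈ range (n + 1), (t + k))
      ((2 : ℝ) ^ n * (n + R)) := by
  refine ⟨fun k => if k ≤ n then (-1) ^ (k + 1) * (n.choose k : ℤ) * (k + R) else 0,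
    fun k => ?_, fun t ht => ?_⟩
  · dsimp only
    by_cases hkn : k ≤ n
    · rw [if_pos hkn]
      push_cast
      rw [abs_mul, abs_mul, abs_pow, abs_neg, abs_one, one_pow, one_mul, Nat.abs_cast,
        show |(k : ℝ) + R| = k + R from abs_of_nonneg (by positivity)]
      have h1 : (n.choose k : ℝ) ≤ 2 ^ n := by exact_mod_cast Nat.choose_le_two_pow n k
      have h2 : (k : ℝ) + R ≤ n + R := by
        have : (k : ℝ) ≤ n := by exact_mod_cast hkn
        linarith
      exact mul_le_mul h1 h2 (by positivity) (by positivity)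
    · rw [if_neg hkn]; simp only [Int.cast_zero, abs_zero]; positivity
  · have hdeg : (Polynomial.C (n ! : ℝ) * (Polynomial.X - Polynomial.C (R : ℝ))).natDegree ≤ n := by
      refine (Polynomial.natDegree_C_mul_le _ _).trans ?_
      rw [Polynomial.natDegree_X_sub_C]
      exact hn
    have h := eval_div_prod_eq_sum (n := n)
      (Polynomial.C (n ! : ℝ) * (Polynomial.X - Polynomial.C (R : ℝ))) hdeg t ht
    simp only [Polynomial.eval_mul, Polynomial.eval_C, Polynomial.eval_sub, Polynomial.eval_X] at h
    beta_reduce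
    rw [h]
    refine sum_congr rfl fun k hk => ?_
    have hkn : k ≤ n := by simpa [Nat.lt_succ_iff] using hk
    rw [if_pos hkn]
    have e : (((-1 : ℤ) ^ (k + 1) * (n.choose k : ℤ) * (k + R) : ℤ) : ℝ) =
        (-1) ^ (k + 1) * ((n ! : ℝ) / (k ! * (n - k)!)) * (k + R) := by
      push_cast
      rw [factorial_div_eq_choose hkn]
    rw [e]
    congr 1
    ring

/-- `|∏_{j<n}(N+j)| ≤ n! · C(|N|+n, n)` for an integer `N`. [folklore] -/
theorem abs_prod_add_le (N : ℤ) (n : ℕ) :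
    |((∏ j ∈ range n, (N + j) : ℤ) : ℝ)| ≤ (n ! : ℝ) * ((N.natAbs + n).choose n : ℕ) := by
  have h1 : |((∏ j ∈ range n, (N + j) : ℤ) : ℝ)| ≤ ∏ j ∈ range n, ((N.natAbs : ℝ) + j) := by
    push_cast
    rw [Finset.abs_prod]
    refine prod_le_prod (fun j _ => abs_nonneg _) fun j _ => ?_
    calc |(N : ℝ) + j| ≤ |(N : ℝ)| + |(j : ℝ)| := abs_add_le _ _
      _ = (N.natAbs : ℝ) + j := by
          rw [Nat.abs_cast, Nat.cast_natAbs, Int.cast_abs]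
  have h2 : ∏ j ∈ range n, ((N.natAbs : ℝ) + j) = ((N.natAbs.ascFactorial n : ℕ) : ℝ) := by
    rw [Nat.ascFactorial_eq_prod_range]; push_cast; rfl
  have h3 : N.natAbs.ascFactorial n ≤ n ! * (N.natAbs + n).choose n := by
    rw [Nat.ascFactorial_eq_factorial_mul_choose']
    exact Nat.mul_le_mul_left _ (Nat.choose_le_choose n (Nat.sub_le _ _))
  calc |((∏ j ∈ range n, (N + j) : ℤ) : ℝ)| ≤ ((N.natAbs.ascFactorial n : ℕ) : ℝ) := by rw [← h2]; exact h1
    _ ≤ ((n ! * (N.natAbs + n).choose n : ℕ) : ℝ) := by exact_mod_cast h3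
    _ = (n ! : ℝ) * ((N.natAbs + n).choose n : ℕ) := by push_cast; ring

/-- **`F` with bounds** (`D = 1`): `∏_{j<n}(t + A + j + 1)/∏_{k ≤ n}(t+k)` has integer residues
`(-1)^k C(n,k) ∏_{j<n}(A - k + 1 + j)/n!`, bounded by `2^n · C(|A| + 2n + 1, n)`.
[cite: FischlerSprangZudilin2019, §3 (coefficients A_{α,k}, α ∈ ℤ)] -/
theorem isSimpleB_F (n : ℕ) (A : ℤ) :
    IsSimpleB n (fun t => (∏ j ∈ range n, (t + (A : ℝ) + ((j : ℝ) + 1))) /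
      ∏ k ∈ range (n + 1), (t + k)) ((2 : ℝ) ^ n * ((A.natAbs + 2 * n + 1).choose n : ℕ)) := by
  have hdvd : ∀ k : ℕ, (n ! : ℤ) ∣ ∏ j ∈ range n, ((A - k + 1) + j) := fun k =>
    factorial_dvd_prod_add _ n
  refine ⟨fun k => if k ≤ n then
      (-1) ^ k * (n.choose k : ℤ) * ((∏ j ∈ range n, ((A - k + 1) + j)) / n !) else 0,
    fun k => ?_, fun t ht => ?_⟩
  · dsimp only
    by_cases hkn : k ≤ n
    · rw [if_pos hkn]
      obtain ⟨q, hq⟩ := hdvd k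
      have hq' : (∏ j ∈ range n, ((A - k + 1) + j)) / (n ! : ℤ) = q := by
        rw [hq]; exact Int.mul_ediv_cancel_left _ (by exact_mod_cast (Nat.factorial_pos n).ne')
      rw [hq']
      have hfac : (0 : ℝ) < n ! := by exact_mod_cast Nat.factorial_pos n
      -- `|q| ≤ C(|A - k + 1| + n, n) ≤ C(|A| + 2n + 1, n)`
      have hqb : |(q : ℝ)| ≤ ((A.natAbs + 2 * n + 1).choose n : ℕ) := by
        have h1 := abs_prod_add_le (A - k + 1) n
        rw [hq] at h1
        push_cast at h1
        rw [abs_mul, Nat.abs_cast] at h1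
        have h2 : |(q : ℝ)| ≤ (((A - k + 1).natAbs + n).choose n : ℕ) :=
          le_of_mul_le_mul_left (by linarith [h1]) hfac
        refine h2.trans ?_
        have : (A - k + 1).natAbs + n ≤ A.natAbs + 2 * n + 1 := by omega
        exact_mod_cast Nat.choose_le_choose n this
      push_cast
      rw [abs_mul, abs_mul, abs_pow, abs_neg, abs_one, one_pow, one_mul, Nat.abs_cast]
      have h1 : (n.choose k : ℝ) ≤ 2 ^ n := by exact_mod_cast Nat.choose_le_two_pow n k
      exact mul_le_mul h1 hqb (abs_nonneg _) (by positivity)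
    · rw [if_neg hkn]; simp only [Int.cast_zero, abs_zero]; positivity
  · set P : Polynomial ℝ := ∏ j ∈ range n, (Polynomial.X + Polynomial.C ((A : ℝ) + ((j : ℝ) + 1)))
      with hP
    have hdeg : P.natDegree ≤ n := by
      refine (Polynomial.natDegree_prod_le _ _).trans ?_
      have : ∀ j ∈ range n, (Polynomial.X + Polynomial.C ((A : ℝ) + ((j : ℝ) + 1))).natDegree ≤ 1 := by
        intro j _
        rw [Polynomial.natDegree_X_add_C]
      calc ∑ j ∈ range n, (Polynomial.X + Polynomial.C ((A : ℝ) + ((j : ℝ) + 1))).natDegree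
          ≤ ∑ _j ∈ range n, (1 : ℕ) :=
            sum_le_sum (f := fun j : ℕ =>
              (Polynomial.X + Polynomial.C ((A : ℝ) + ((j : ℝ) + 1))).natDegree) this
        _ = n := by simp
    have h := eval_div_prod_eq_sum (n := n) P hdeg t ht
    have hevt : P.eval t = ∏ j ∈ range n, (t + (A : ℝ) + ((j : ℝ) + 1)) := by
      rw [hP, Polynomial.eval_prod]
      refine prod_congr rfl fun j _ => ?_
      simp only [Polynomial.eval_add, Polynomial.eval_X, Polynomial.eval_C]
      ring
    rw [hevt] at h
    beta_reduce
    rw [h]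
    refine sum_congr rfl fun k hk => ?_
    have hkn : k ≤ n := by simpa [Nat.lt_succ_iff] using hk
    rw [if_pos hkn]
    have hevk : P.eval (-(k : ℝ)) = ((∏ j ∈ range n, ((A - k + 1) + j) : ℤ) : ℝ) := by
      rw [hP, Polynomial.eval_prod]
      push_cast
      refine prod_congr rfl fun j _ => ?_
      simp only [Polynomial.eval_add, Polynomial.eval_X, Polynomial.eval_C]
      ring
    obtain ⟨q, hq⟩ := hdvd k
    have hq' : (∏ j ∈ range n, ((A - k + 1) + j)) / (n ! : ℤ) = q := by
      rw [hq]; exact Int.mul_ediv_cancel_left _ (by exact_mod_cast (Nat.factorial_pos n).ne')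
    have e : (((-1 : ℤ) ^ k * (n.choose k : ℤ) * ((∏ j ∈ range n, ((A - k + 1) + j)) / n !) : ℤ)
        : ℝ) = (-1) ^ k / (k ! * (n - k)!) * P.eval (-(k : ℝ)) := by
      rw [hq', hevk, hq]
      push_cast
      rw [← factorial_div_eq_choose hkn]
      ring
    rw [e]

/-! ### The Ball–Rivoal function: bounded integral expansion of level `a+1` -/

/-- The coefficient bound: `2^{n(a+1)} (n + rn) C((r+2)n... )`; precisely
`coeffBound a r n = [2^n (n+rn)(n+1)] · [2^n]^{a-2r-1} · [2^n C(3rn... )]...` — we keep it as the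
explicit product appearing in the construction:
`(n+1) 2^n (n+rn) · (2^n)^{a-2r-1} · (2^n C((r+2)n+1, n))^{2r+1} · ((n+1)²(a+1)(a+2))^{a}`.
[folklore] -/
def coeffBound (a r n : ℕ) : ℝ :=
  ((n : ℝ) + 1) * ((2 : ℝ) ^ n * (n + r * n)) * ((2 : ℝ) ^ n) ^ (a - 2 * r - 1) *
    ((2 : ℝ) ^ n * (((r * n + 2 * n + 1).choose n : ℕ) : ℝ)) ^ (2 * r + 1) *
    (((n : ℝ) + 1) ^ 2 * ((a : ℝ) + 1) * ((a : ℝ) + 2)) ^ a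

/-- `0 ≤ coeffBound`. [folklore] -/
theorem coeffBound_nonneg (a r n : ℕ) : 0 ≤ coeffBound a r n := by
  unfold coeffBound; positivity

/-- **Bounded integral expansion of `R_n`** (Ball–Rivoal 2001, Lemmes 4 and 5, in the
elementary form of FSZ 2019, (3.3) with `D = 1`): `OddZeta.Rfun r 1 a n` is an integral
expansion of level `a+1` with coefficients bounded by `coeffBound a r n`, for `n ≥ 1`,
`2r + 1 ≤ a`. [cite: BallRivoal2001, Lemmes 4, 5] -/
theorem isExpB_Rfun {a r n : ℕ} (hn : 1 ≤ n) (ha : 2 * r + 1 ≤ a) :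
    IsExpB n (a + 1) (Rfun r 1 a n) (coeffBound a r n) := by
  set p := a - (2 * r + 1) with hp
  set B := 2 * r + 1 with hB
  -- the three kinds of factors
  set Gt : ℝ → ℝ := fun t => (n ! : ℝ) * (t - (r * n : ℕ)) / ∏ k ∈ range (n + 1), (t + k)
    with hGt
  set G : ℝ → ℝ := fun t => (n ! : ℝ) / ∏ k ∈ range (n + 1), (t + k) with hG
  set F : ℕ → ℝ → ℝ := fun b t =>
      (∏ j ∈ range n, (t + (((b * n : ℕ) : ℤ) - ((r * n : ℕ) : ℤ) : ℤ) + ((j : ℝ) + 1))) /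
      ∏ k ∈ range (n + 1), (t + k) with hF
  have h1 : IsExpB n 1 Gt ((n + 1) * ((2 : ℝ) ^ n * (n + (r * n : ℕ)))) :=
    (isSimpleB_Gtilde n (r * n) hn).isExpB
  have h2 := h1.mul_prod_isSimpleB (P := a + 1) (range p) (E := fun _ => (2 : ℝ) ^ n)
    (fun _ _ => isSimpleB_G n) (by rw [card_range]; omega)
  have h3 := h2.mul_prod_isSimpleB (P := a + 1) (range B)
    (E := fun b => (2 : ℝ) ^ n * (((((b * n : ℕ) : ℤ) - ((r * n : ℕ) : ℤ) : ℤ).natAbs + 2 * n + 1).choose n : ℕ))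
    (fun b _ => isSimpleB_F n _) (by rw [card_range, card_range]; omega)
  rw [card_range, card_range] at h3
  have hlev : 1 + p + B = a + 1 := by omega
  rw [hlev] at h3
  -- compare the bound with `coeffBound`
  set Λ : ℝ := ((n : ℝ) + 1) ^ 2 * ((a + 1 : ℕ) : ℝ) * (((a + 1 : ℕ) : ℝ) + 1) with hΛ
  set X : ℝ := ((n : ℝ) + 1) * ((2 : ℝ) ^ n * ((n : ℝ) + ((r * n : ℕ) : ℝ))) with hX
  set Cb : ℝ := (((r * n + 2 * n + 1).choose n : ℕ) : ℝ) with hCb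
  have hEF : ∏ b ∈ range B, (2 : ℝ) ^ n *
      ((((((b * n : ℕ) : ℤ) - ((r * n : ℕ) : ℤ) : ℤ).natAbs + 2 * n + 1).choose n : ℕ) : ℝ) ≤
      ((2 : ℝ) ^ n * Cb) ^ B := by
    have e : ((2 : ℝ) ^ n * Cb) ^ B = ∏ _b ∈ range B, ((2 : ℝ) ^ n * Cb) := by
      rw [prod_const, card_range]
    rw [e]
    refine prod_le_prod (fun b _ => by positivity) fun b hb => ?_
    have hb' : b < B := mem_range.1 hb
    refine mul_le_mul_of_nonneg_left ?_ (by positivity)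
    have : (((b * n : ℕ) : ℤ) - ((r * n : ℕ) : ℤ) : ℤ).natAbs + 2 * n + 1 ≤ r * n + 2 * n + 1 := by
      have hb2 : b * n ≤ 2 * (r * n) := by
        have := Nat.mul_le_mul_right n (show b ≤ 2 * r by omega)
        simpa [mul_assoc] using this
      generalize b * n = u at hb2 ⊢
      generalize r * n = v at hb2 ⊢
      omega
    rw [hCb]
    exact_mod_cast Nat.choose_le_choose n this
  have hΛ' : Λ = ((n : ℝ) + 1) ^ 2 * ((a : ℝ) + 1) * ((a : ℝ) + 2) := by
    rw [hΛ]; push_cast; ring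
  have hΛ1 : 1 ≤ Λ := by
    rw [hΛ']
    have h1 : (1 : ℝ) ≤ ((n : ℝ) + 1) ^ 2 := one_le_pow₀ (by linarith [(Nat.cast_nonneg n : (0 : ℝ) ≤ n)])
    have ha0 : (0 : ℝ) ≤ a := Nat.cast_nonneg a
    exact one_le_mul_of_one_le_of_one_le (one_le_mul_of_one_le_of_one_le h1 (by linarith))
      (by linarith)
  have hbound : X * (∏ _j ∈ range p, (2 : ℝ) ^ n) * Λ ^ p *
      (∏ b ∈ range B, (2 : ℝ) ^ n *
        ((((((b * n : ℕ) : ℤ) - ((r * n : ℕ) : ℤ) : ℤ).natAbs + 2 * n + 1).choose n : ℕ) : ℝ)) *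
      Λ ^ B ≤ coeffBound a r n := by
    have hX0 : 0 ≤ X := by rw [hX]; positivity
    calc X * (∏ _j ∈ range p, (2 : ℝ) ^ n) * Λ ^ p *
          (∏ b ∈ range B, (2 : ℝ) ^ n *
            ((((((b * n : ℕ) : ℤ) - ((r * n : ℕ) : ℤ) : ℤ).natAbs + 2 * n + 1).choose n : ℕ) : ℝ)) *
          Λ ^ B
        ≤ X * (∏ _j ∈ range p, (2 : ℝ) ^ n) * Λ ^ p * ((2 : ℝ) ^ n * Cb) ^ B * Λ ^ B := by
          gcongr
      _ = X * ((2 : ℝ) ^ n) ^ p * ((2 : ℝ) ^ n * Cb) ^ B * Λ ^ (p + B) := by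
          rw [prod_const, card_range, pow_add]; ring
      _ ≤ X * ((2 : ℝ) ^ n) ^ p * ((2 : ℝ) ^ n * Cb) ^ B * Λ ^ a := by
          refine mul_le_mul_of_nonneg_left (pow_le_pow_right₀ hΛ1 (by omega)) (by positivity)
      _ = coeffBound a r n := by
          unfold coeffBound
          rw [hX, hΛ', hCb, show a - 2 * r - 1 = p by omega, ← hB]
          push_cast
          ring
  refine (h3.mono_bound hbound).congr fun t ht => ?_
  -- the algebraic identity `R_n = G̃ · G^p · ∏ F_b`
  have hP : ∏ k ∈ range (n + 1), (t + k) ≠ 0 :=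
    prod_ne_zero_iff.2 fun k hk => ht k (by simpa [Nat.lt_succ_iff] using hk)
  set P := ∏ k ∈ range (n + 1), (t + k) with hPdef
  have hnum : ∏ b ∈ range B, ∏ j ∈ range n,
      (t + (((b * n : ℕ) : ℤ) - ((r * n : ℕ) : ℤ) : ℤ) + ((j : ℝ) + 1)) =
      ∏ l ∈ range (Lnum r 1 n), (t - r * n + ((l : ℝ) + 1)) := by
    rw [Lnum, show (2 * r + 1) * 1 * n = B * n by rw [hB]; ring]
    rw [← prod_range_mul_nest (fun l => t - r * n + ((l : ℝ) + 1)) B n]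
    refine prod_congr rfl fun b _ => prod_congr rfl fun j _ => ?_
    push_cast
    ring
  have hGprod : ∏ _i ∈ range p, G t = ((n ! : ℝ) / P) ^ p := by
    rw [prod_const, card_range]
  have hFprod : ∏ b ∈ range B, F b t =
      (∏ l ∈ range (Lnum r 1 n), (t - r * n + ((l : ℝ) + 1))) / P ^ B := by
    rw [hF]
    simp only
    rw [prod_div_distrib, prod_const, card_range, hnum]
  rw [hGprod, hFprod, hGt, Rfun]
  simp only
  rw [← hPdef]
  have hsplit : ∏ l ∈ range (Lnum r 1 n + 1), (t - r * n + (l : ℝ) / ((1 : ℕ) : ℝ)) =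
      (t - r * n) * ∏ l ∈ range (Lnum r 1 n), (t - r * n + ((l : ℝ) + 1)) := by
    rw [prod_range_succ']
    push_cast
    simp only [div_one, add_zero]
    ring
  have hden : ∏ k ∈ range (n + 1), (t + k) ^ (a + 1) = P ^ (a + 1) := by
    rw [prod_pow]
  rw [hsplit, hden]
  have hpow : (n ! : ℝ) ^ (a + 1 - (2 * r + 1) * 1) = (n ! : ℝ) * (n ! : ℝ) ^ p := by
    rw [show a + 1 - (2 * r + 1) * 1 = p + 1 by omega, pow_succ]
    ring
  rw [hpow, div_pow]
  have ha1 : a + 1 = 1 + p + B := hlev.symm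
  rw [ha1, pow_add, pow_add, pow_one]
  push_cast
  field_simp
  rw [one_pow, one_mul]

/-! ### Symmetrisation and the linear forms, with bounds -/

/-- **Symmetrised bounded expansion** (Ball–Rivoal 2001, Lemme 1, via the averaging of the
tree's `OddZeta.exists_symm_exp`): for `n` even and `a` odd, `R_n` has for `t > 0` an expansion
with `2 d_n^{a+1-i} b_{k,i} ∈ ℤ`, `|b_{k,i}| ≤ coeffBound`, and `∑_k b_{k,i} = 0` for even `i`.
[cite: BallRivoal2001, Lemme 1] -/
theorem exists_symm_expB {a r n : ℕ} (hn : 1 ≤ n) (heven : Even n) (hodd : Odd a)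
    (ha : 2 * r + 1 ≤ a) :
    ∃ b : ℕ → ℕ → ℝ, (∀ k i, IsZ (2 * dn n ^ (a + 1 - i) * b k i)) ∧
      (∀ k i, |b k i| ≤ coeffBound a r n) ∧
      (∀ i, Even i → ∑ k ∈ range (n + 1), b k i = 0) ∧
      ∀ t : ℝ, 0 < t → Rfun r 1 a n t = pfEval n (a + 1) b t := by
  obtain ⟨c, hc, hcb, hrep⟩ := isExpB_Rfun hn ha
  have hL : Even (Lnum r 1 n) := by
    rw [Lnum]; exact heven.mul_left _
  refine ⟨fun k i => (c k i + (-1) ^ (i + 1) * c (n - k) i) / 2, fun k i => ?_, fun k i => ?_,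
    fun i hi => ?_, fun t ht => ?_⟩
  · have : 2 * dn n ^ (a + 1 - i) * ((c k i + (-1) ^ (i + 1) * c (n - k) i) / 2) =
        dn n ^ (a + 1 - i) * c k i + (-1) ^ (i + 1) * (dn n ^ (a + 1 - i) * c (n - k) i) := by
      ring
    rw [this]
    exact (hc k i).add ((IsZ.neg_one_pow _).mul (hc (n - k) i))
  · rw [abs_div, abs_two]
    have h1 : |c k i + (-1) ^ (i + 1) * c (n - k) i| ≤ coeffBound a r n + coeffBound a r n := by
      refine (abs_add_le _ _).trans (add_le_add (hcb k i) ?_)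
      rw [abs_mul, abs_pow, abs_neg, abs_one, one_pow, one_mul]
      exact hcb _ _
    linarith
  · have h1 : (-1 : ℝ) ^ (i + 1) = -1 := Odd.neg_one_pow (hi.add_one)
    simp only [h1, neg_one_mul, ← sub_eq_add_neg, ← sum_div, sum_sub_distrib]
    rw [sum_range_reflect' (fun k => c k i) n, sub_self, zero_div]
  · have hA : Rfun r 1 a n t = pfEval n (a + 1) c t := hrep t (good_of_pos ht)
    have hB : Rfun r 1 a n t = -pfEval n (a + 1) c (-n - t) := by
      have h1 := Rfun_neg (r := r) (s := a) one_pos hL hodd t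
      have h2 : Good n (-(n : ℝ) - t) := good_of_lt_neg (by linarith)
      rw [hrep _ h2] at h1
      linarith
    have hB' : -pfEval n (a + 1) c (-n - t) =
        ∑ k ∈ range (n + 1), ∑ i ∈ Icc 1 (a + 1), (-1) ^ (i + 1) * c (n - k) i / (t + k) ^ i := by
      rw [pfEval, ← sum_range_reflect' (fun k => ∑ i ∈ Icc 1 (a + 1),
        c k i / (-(n : ℝ) - t + k) ^ i) n]
      rw [← sum_neg_distrib]
      refine sum_congr rfl fun k hk => ?_
      have hkn : k ≤ n := by simpa [Nat.lt_succ_iff] using hk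
      rw [← sum_neg_distrib]
      refine sum_congr rfl fun i _ => ?_
      rw [Nat.cast_sub hkn]
      have : (-(n : ℝ) - t + (n - k)) = -(t + k) := by ring
      have hinv : ((-1 : ℝ) ^ i)⁻¹ = (-1) ^ i := by rw [← inv_pow, inv_neg, inv_one]
      rw [this, neg_pow, pow_succ, mul_comm ((-1 : ℝ) ^ i) _, ← div_div,
        div_eq_mul_inv _ ((-1 : ℝ) ^ i), hinv]
      ring
    have : Rfun r 1 a n t = (pfEval n (a + 1) c t + -pfEval n (a + 1) c (-n - t)) / 2 := by
      linarith
    rw [this, hB', pfEval, pfEval, ← sum_add_distrib, sum_div]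
    refine sum_congr rfl fun k _ => ?_
    rw [← sum_add_distrib, sum_div]
    refine sum_congr rfl fun i _ => ?_
    ring

/-- `0 ≤ hzp i 1 M ≤ M`: the partial Hurwitz sums at `α = 1` have terms `≤ 1`. [folklore] -/
theorem hzp_one_le (i M : ℕ) : 0 ≤ hzp i 1 M ∧ hzp i 1 M ≤ M := by
  unfold hzp
  constructor
  · exact sum_nonneg fun ν _ => by positivity
  · calc ∑ ν ∈ range M, 1 / ((ν : ℝ) + 1) ^ i ≤ ∑ _ν ∈ range M, (1 : ℝ) := by
          refine sum_le_sum fun ν _ => ?_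
          rw [div_le_one (by positivity)]
          exact one_le_pow₀ (by linarith [(Nat.cast_nonneg ν : (0 : ℝ) ≤ ν)])
      _ = M := by simp

/-- **The linear forms with bounds** (Rivoal 2000, Lemmes 1, 4, 5; Ball–Rivoal 2001; in the
form of the tree's `OddZeta.linear_forms` with `D = 1`, plus the growth estimate). For `n ≥ 1`
even, `a` odd, `2r + 2 ≤ a`: there are reals `ρ_i`, `ρ₀` with `ρ_i = 0` for even `i`,
`2 d_n^{a+1-i} ρ_i ∈ ℤ`, `2 d_{n+1}^{a+1} ρ₀ ∈ ℤ`, `|ρ_i| ≤ (n+1)·coeffBound`,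
`|ρ₀| ≤ (n+1)²(a+1)·coeffBound`, and `∑_{m ≥ 0} R_n(m+2) = ρ₀ + ∑_{2 ≤ i ≤ a+1} ρ_i ζ(i,1)`.
[cite: Rivoal2000, Lemmes 1, 4, 5] -/
theorem linear_forms_bound {a r n : ℕ} (hn : 1 ≤ n) (heven : Even n) (hodd : Odd a)
    (ha : 2 * r + 2 ≤ a) :
    ∃ (ρ : ℕ → ℝ) (ρ0 : ℝ),
      (∀ i, Even i → ρ i = 0) ∧
      (∀ i, IsZ (2 * dn n ^ (a + 1 - i) * ρ i)) ∧
      IsZ (2 * dn (n + 1) ^ (a + 1) * ρ0) ∧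
      (∀ i, |ρ i| ≤ ((n : ℝ) + 1) * coeffBound a r n) ∧
      |ρ0| ≤ ((n : ℝ) + 1) ^ 2 * ((a : ℝ) + 1) * coeffBound a r n ∧
      HasSum (fun m : ℕ => Rfun r 1 a n ((m : ℝ) + 1 + 1))
        (ρ0 + ∑ i ∈ Icc 2 (a + 1), ρ i * hz i 1) := by
  obtain ⟨b, hbZ, hbB, hbeven, hbrep⟩ := exists_symm_expB (r := r) hn heven hodd (by omega)
  have hs' : (2 * r + 1) * 1 + 2 ≤ a + 1 := by omega
  have hb1 : ∑ k ∈ range (n + 1), b k 1 = 0 :=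
    sum_coeff_one_eq_zero hn one_pos hs' (p := a + 1) (by omega) (T := 0) fun t ht => hbrep t ht
  have hC := coeffBound_nonneg a r n
  refine ⟨fun i => ∑ k ∈ range (n + 1), b k i,
    -∑ k ∈ range (n + 1), ∑ i ∈ Icc 1 (a + 1), b k i * hzp i 1 (k + 1),
    fun i hi => hbeven i hi, fun i => ?_, ?_, fun i => ?_, ?_, ?_⟩
  · rw [mul_sum]
    exact IsZ.sum _ fun k _ => hbZ k i
  · rw [mul_neg, mul_sum]
    refine IsZ.neg (IsZ.sum _ fun k hk => ?_)
    have hkn : k ≤ n := by simpa [Nat.lt_succ_iff] using hk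
    rw [mul_sum]
    refine IsZ.sum _ fun i hi => ?_
    obtain ⟨hi1, hi2⟩ := mem_Icc.1 hi
    rw [hzp, mul_sum, mul_sum]
    refine IsZ.sum _ fun ν hν => ?_
    have hνk : ν ≤ k := Nat.lt_succ_iff.1 (mem_range.1 hν)
    have hq1 : 1 ≤ ν + 1 := by omega
    have hq2 : ν + 1 ≤ n + 1 := by omega
    have hdn : dn n ≠ 0 := (dn_pos n).ne'
    have hnN : n ≤ n + 1 := by omega
    have key : 2 * dn (n + 1) ^ (a + 1) * (b k i * (1 / ((ν : ℝ) + 1) ^ i)) =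
        (2 * dn n ^ (a + 1 - i) * b k i) * (dn (n + 1) / dn n) ^ (a + 1 - i) *
          (dn (n + 1) / ((ν + 1 : ℕ) : ℝ)) ^ i := by
      have e1 : (ν : ℝ) + 1 = ((ν + 1 : ℕ) : ℝ) := by push_cast; ring
      rw [e1, show dn (n + 1) ^ (a + 1) = dn (n + 1) ^ (a + 1 - i) * dn (n + 1) ^ i by
        rw [← pow_add]; congr 1; omega]
      have hdN : dn (n + 1) ≠ 0 := (dn_pos (n + 1)).ne'
      have hν0 : ((ν + 1 : ℕ) : ℝ) ≠ 0 := by positivity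
      rw [div_pow, div_pow]
      field_simp
    rw [key]
    exact ((hbZ k i).mul ((isZ_dn_div_dn hnN).pow _)).mul ((isZ_dn_div_nat hq1 hq2).pow _)
  · calc |∑ k ∈ range (n + 1), b k i| ≤ ∑ k ∈ range (n + 1), |b k i| := abs_sum_le_sum_abs _ _
      _ ≤ ∑ _k ∈ range (n + 1), coeffBound a r n := sum_le_sum fun k _ => hbB k i
      _ = ((n : ℝ) + 1) * coeffBound a r n := by rw [sum_const, card_range, nsmul_eq_mul]; push_cast; ring
  · rw [abs_neg]
    calc |∑ k ∈ range (n + 1), ∑ i ∈ Icc 1 (a + 1), b k i * hzp i 1 (k + 1)|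
        ≤ ∑ k ∈ range (n + 1), ∑ i ∈ Icc 1 (a + 1), |b k i * hzp i 1 (k + 1)| := by
          refine (abs_sum_le_sum_abs _ _).trans (sum_le_sum fun k _ => abs_sum_le_sum_abs _ _)
      _ ≤ ∑ _k ∈ range (n + 1), ∑ _i ∈ Icc 1 (a + 1), coeffBound a r n * ((n : ℝ) + 1) := by
          refine sum_le_sum fun k hk => sum_le_sum fun i _ => ?_
          have hkn : k ≤ n := by simpa [Nat.lt_succ_iff] using hk
          obtain ⟨h0, hM⟩ := hzp_one_le i (k + 1)
          rw [abs_mul, abs_of_nonneg h0]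
          refine mul_le_mul (hbB k i) (hM.trans ?_) h0 hC
          have : ((k + 1 : ℕ) : ℝ) ≤ n + 1 := by exact_mod_cast Nat.succ_le_succ hkn
          exact_mod_cast this
      _ = ((n : ℝ) + 1) ^ 2 * ((a : ℝ) + 1) * coeffBound a r n := by
          rw [sum_const, sum_const, card_range, Nat.card_Icc, nsmul_eq_mul, nsmul_eq_mul]
          push_cast
          ring
  · have h := hasSum_Rfun_shift hn one_pos hs' (p := a + 1) (by omega) hbrep hb1
      (α := 1) one_pos
    convert h using 1
    rw [sub_eq_neg_add]
    congr 1
    rw [sum_comm]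
    refine sum_congr rfl fun i _ => ?_
    rw [sum_mul]

end RivoalSeries

end Literature.NumberTheory.Transcendental
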